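import Mathlib
import Summits.Ventures.PercRepro2.Defs
import Summits.Ventures.PercRepro2.Independence
import Summits.Ventures.PercRepro2.Harris
import Summits.Ventures.PercRepro2.Graph
import Summits.Ventures.PercRepro2.Exploration
import Summits.Ventures.PercRepro2.Events
import Summits.Ventures.PercRepro2.Statements
import Summits.Ventures.PercRepro2.FourFunctions
import Summits.Ventures.PercRepro2.Induced
import Summits.Ventures.PercRepro2.Frontier
import Summits.Ventures.PercRepro2.ObsIndependence
import Summits.Ventures.PercRepro2.BHK
import Summits.Ventures.PercRepro2.BHKEvents
import Summits.Ventures.PercRepro2.ClusterProperty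
import Summits.Ventures.PercRepro2.BHKPair
import Summits.Ventures.PercRepro2.CondAvoidPA

/-!
# (Z)-positive association given avoidance
(blind cell PercRepro2, mine-1 g39; proofs/MINE1-UNIONROW2.md §2, the inequality (P2))

`CondAvoid.pa_given_avoid` says that increasing cluster properties of `s` are positively
associated conditionally on the cluster of `t` avoiding a set `X ∋ s`. Here the functionals may
depend on BOTH clusters: for `Φ, Φ' : Set V → Set V → R` increasing in the first argument and
decreasing in the second (`IsZMono`, the (Z)-class of van den Berg–Häggström–Kahn), with values in
`[0, 1]`, and `A = {t ↮ X}`,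

  `E[Φ(C_s, C_t) 1_A] · E[Φ'(C_s, C_t) 1_A] ≤ E[Φ(C_s, C_t) Φ'(C_s, C_t) 1_A] · P(A)`.

The proof is the exploration argument of `pa_given_avoid` verbatim, with the cluster of `t`
explored: given `C_t = C` the section `Φ(·, C)` is a monotone cluster property of `s`
(`sect`), so the tower identity `expect_mul_eq_expect_delExpect` applies per explored cluster
(summed over the finitely many clusters: `expect_zfun_mul_eq`), Harris in `G ∖ C` gives
`delExpect_mul_le_delExpect_mul`, the explored forms `C ↦ E[Φ(C_s in G ∖ C, C)]` are ANTITONE in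
`C` (`zdel_anti`: a larger explored cluster shrinks `C_s` and lowers the second argument), and
BHK 1.1 with the avoided set `X` (`bhk_induced`) integrates. With `X = {s}` this is the (Z)-PA on
`{s ↮ t}`; with `X = {s, v}`, `{s, u}`, `{s, u, v}` it is exactly what the two-status union row
needs (`UnionRowMech.single_exclusion_nonneg`, `double_exclusion_nonneg`).
-/

namespace Summit.Ventures.PercRepro2

namespace CondAvoid

open Finset

variable {V : Type*} {E : Type*} [Fintype E] [DecidableEq E] [Fintype V] [DecidableEq V]
  {R : Type*} [Field R] [LinearOrder R] [IsStrictOrderedRing R]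

/-- A function of two clusters, increasing in the first and decreasing in the second. -/
def IsZMono (Φ : Set V → Set V → R) : Prop :=
  ∀ ⦃W W' C C' : Set V⦄, W ⊆ W' → C' ⊆ C → Φ W C ≤ Φ W' C'

omit [Fintype E] [DecidableEq E] [Fintype V] [DecidableEq V] [Field R] [LinearOrder R]
  [IsStrictOrderedRing R] in
/-- The section of `Φ` at a fixed second cluster, as a cluster property of the first vertex. -/
def sect (ends : E → Sym2 V) (Φ : Set V → Set V → R) (C : Set V) : V → Config E → R :=
  fun v ω => Φ (cluster ends ω v) C

omit [Fintype E] [DecidableEq E] [Fintype V] [DecidableEq V] [Field R] [IsStrictOrderedRing R] in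
/-- The section at a fixed second cluster is a monotone cluster property. -/
lemma isMonotoneClusterProperty_sect {ends : E → Sym2 V} {Φ : Set V → Set V → R}
    (hΦ : IsZMono Φ) (C : Set V) : IsMonotoneClusterProperty ends (sect ends Φ C) where
  mono _ _ _ h := hΦ h (subset_refl C)
  eq_of_openAdj _ _ _ h := by
    simp only [sect]
    rw [cluster_eq_of_conn (conn_of_openAdj h)]

omit [Fintype E] [DecidableEq E] [Fintype V] [DecidableEq V] in
/-- The product of two nonnegative (Z)-monotone functions is (Z)-monotone. -/
lemma isZMono_mul {Φ Φ' : Set V → Set V → R} (hΦ : IsZMono Φ) (hΦ' : IsZMono Φ')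
    (hΦ0 : ∀ W C, 0 ≤ Φ W C) (hΦ'0 : ∀ W C, 0 ≤ Φ' W C) :
    IsZMono (fun W C => Φ W C * Φ' W C) :=
  fun _ _ _ _ h1 h2 => mul_le_mul (hΦ h1 h2) (hΦ' h1 h2) (hΦ'0 _ _) (hΦ0 _ _)

/-- The explored form `C ↦ E[Φ(C_s in G ∖ C, C)]`. -/
noncomputable def zdel (p : E → R) (ends : E → Sym2 V) (Φ : Set V → Set V → R) (s : V)
    (C : Set V) : R :=
  delExpect p ends (sect ends Φ C) s C

omit [Fintype V] [DecidableEq V] in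
/-- The explored form is antitone in the explored cluster. -/
lemma zdel_anti (p : E → R) (hp : IsProbVec p) (ends : E → Sym2 V) {Φ : Set V → Set V → R}
    (hΦ : IsZMono Φ) (s : V) : Antitone (zdel p ends Φ s) := by
  intro C C' h
  calc zdel p ends Φ s C' = delExpect p ends (sect ends Φ C') s C' := rfl
    _ ≤ delExpect p ends (sect ends Φ C') s C :=
        delExpect_anti p hp ends (isMonotoneClusterProperty_sect hΦ C') s h
    _ ≤ delExpect p ends (sect ends Φ C) s C := by
        unfold delExpect
        exact expect_mono hp fun ω => hΦ (subset_refl _) h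

omit [Fintype V] [DecidableEq V] [LinearOrder R] [IsStrictOrderedRing R] in
/-- Expectation of a finite sum. -/
lemma expect_finset_sum (p : E → R) {ι : Type*} (s : Finset ι) (f : ι → Config E → R) :
    expect p (fun ω => ∑ i ∈ s, f i ω) = ∑ i ∈ s, expect p (f i) := by
  unfold expect
  simp_rw [Finset.mul_sum]
  rw [Finset.sum_comm]

omit [DecidableEq V] [IsStrictOrderedRing R] in
/-- **Exploring the cluster of `t` for a function of both clusters**:
`E[F(C_t) Φ(C_s, C_t) 1_{t ↮ s}] = E[F(C_t) · zdel Φ (C_t) · 1_{t ↮ s}]`. -/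
theorem expect_zfun_mul_eq (p : E → R) (ends : E → Sym2 V) (s t : V) (F : Set V → R)
    {Φ : Set V → Set V → R} (hΦ : IsZMono Φ) :
    expect p (fun ω => F (cluster ends ω t) * Φ (cluster ends ω s) (cluster ends ω t) *
        ((connEvent ends t s)ᶜ).indicator 1 ω) =
      expect p (fun ω => F (cluster ends ω t) * zdel p ends Φ s (cluster ends ω t) *
        ((connEvent ends t s)ᶜ).indicator 1 ω) := by
  classical
  set 𝒞 : Finset (Set V) := Finset.univ.image (fun ω : Config E => cluster ends ω t) with h𝒞
  have hmem : ∀ ω : Config E, cluster ends ω t ∈ 𝒞 := fun ω =>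
    Finset.mem_image_of_mem _ (Finset.mem_univ ω)
  -- decompose the left side by the value of `C_t`
  have hL : ∀ ω, F (cluster ends ω t) * Φ (cluster ends ω s) (cluster ends ω t) *
      ((connEvent ends t s)ᶜ).indicator 1 ω =
      ∑ C ∈ 𝒞, (F (cluster ends ω t) * (if cluster ends ω t = C then 1 else 0)) *
        sect ends Φ C s ω * ((connEvent ends t s)ᶜ).indicator 1 ω := by
    intro ω
    have : ∑ C ∈ 𝒞, (F (cluster ends ω t) * (if cluster ends ω t = C then 1 else 0)) *
        sect ends Φ C s ω * ((connEvent ends t s)ᶜ).indicator 1 ω =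
        ∑ C ∈ 𝒞, if cluster ends ω t = C then
          F (cluster ends ω t) * sect ends Φ C s ω * ((connEvent ends t s)ᶜ).indicator 1 ω
          else 0 := by
      refine Finset.sum_congr rfl fun C _ => ?_
      split_ifs <;> simp
    rw [this, Finset.sum_ite_eq, if_pos (hmem ω)]
    rfl
  -- and the right side
  have hR : ∀ ω, F (cluster ends ω t) * zdel p ends Φ s (cluster ends ω t) *
      ((connEvent ends t s)ᶜ).indicator 1 ω =
      ∑ C ∈ 𝒞, (F (cluster ends ω t) * (if cluster ends ω t = C then 1 else 0)) *
        delExpect p ends (sect ends Φ C) s (cluster ends ω t) *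
        ((connEvent ends t s)ᶜ).indicator 1 ω := by
    intro ω
    have : ∑ C ∈ 𝒞, (F (cluster ends ω t) * (if cluster ends ω t = C then 1 else 0)) *
        delExpect p ends (sect ends Φ C) s (cluster ends ω t) *
        ((connEvent ends t s)ᶜ).indicator 1 ω =
        ∑ C ∈ 𝒞, if cluster ends ω t = C then
          F (cluster ends ω t) * delExpect p ends (sect ends Φ C) s (cluster ends ω t) *
            ((connEvent ends t s)ᶜ).indicator 1 ω
          else 0 := by
      refine Finset.sum_congr rfl fun C _ => ?_
      split_ifs <;> simp
    rw [this, Finset.sum_ite_eq, if_pos (hmem ω)]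
    rfl
  simp_rw [hL, hR]
  rw [expect_finset_sum, expect_finset_sum]
  refine Finset.sum_congr rfl fun C _ => ?_
  exact expect_mul_eq_expect_delExpect p ends t s
    (fun W => F W * (if W = C then 1 else 0)) (isMonotoneClusterProperty_sect hΦ C)

/-- **(Z)-positive association given avoidance**: for `Φ, Φ'` increasing in `C_s`, decreasing in
`C_t`, with values in `[0, 1]`, and `X ∋ s`, `A = {t ↮ X}`:
`E[Φ(C_s, C_t) 1_A] · E[Φ'(C_s, C_t) 1_A] ≤ E[Φ(C_s, C_t) Φ'(C_s, C_t) 1_A] · P(A)`. -/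
theorem zpa_given_avoid (p : E → R) (hp : IsProbVec p) (ends : E → Sym2 V) (s t : V)
    {X : Finset V} (hs : s ∈ X) {Φ Φ' : Set V → Set V → R}
    (hΦ : IsZMono Φ) (hΦ' : IsZMono Φ')
    (hΦ0 : ∀ W C, 0 ≤ Φ W C) (hΦ'0 : ∀ W C, 0 ≤ Φ' W C)
    (hΦ1 : ∀ W C, Φ W C ≤ 1) (hΦ'1 : ∀ W C, Φ' W C ≤ 1) :
    expect p (fun ω => Φ (cluster ends ω s) (cluster ends ω t) *
          (avoidEvent ends t X).indicator 1 ω) *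
        expect p (fun ω => Φ' (cluster ends ω s) (cluster ends ω t) *
          (avoidEvent ends t X).indicator 1 ω) ≤
      expect p (fun ω => Φ (cluster ends ω s) (cluster ends ω t) *
          Φ' (cluster ends ω s) (cluster ends ω t) * (avoidEvent ends t X).indicator 1 ω) *
        prob p (avoidEvent ends t X) := by
  classical
  -- the avoidance functional of the cluster of `t`
  set F : Set V → R := fun C => {C : Set V | ∀ x ∈ X, x ∉ C}.indicator 1 C with hF
  have hF0 : ∀ C, 0 ≤ F C := fun C => Set.indicator_nonneg (fun _ _ => zero_le_one) C
  -- the explored forms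
  set g := zdel p ends Φ s with hg
  set g' := zdel p ends Φ' s with hg'
  set g₂ := zdel p ends (fun W C => Φ W C * Φ' W C) s with hg₂
  have hg_anti : Antitone g := zdel_anti p hp ends hΦ s
  have hg'_anti : Antitone g' := zdel_anti p hp ends hΦ' s
  have hg1 : ∀ C, g C ≤ 1 := fun C =>
    delExpect_le p hp ends (sect ends Φ C) s (fun ω => hΦ1 _ _) C
  have hg'1 : ∀ C, g' C ≤ 1 := fun C =>
    delExpect_le p hp ends (sect ends Φ' C) s (fun ω => hΦ'1 _ _) C
  have hmul : ∀ C, g C * g' C ≤ g₂ C := fun C =>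
    delExpect_mul_le_delExpect_mul hp ends (isMonotoneClusterProperty_sect hΦ C)
      (isMonotoneClusterProperty_sect hΦ' C) s C
  -- the tower identities (explore the cluster of `t`)
  have tower : ∀ {Ψ : Set V → Set V → R}, IsZMono Ψ →
      expect p (fun ω => Ψ (cluster ends ω s) (cluster ends ω t) *
          (avoidEvent ends t X).indicator 1 ω) =
        expect p (fun ω => F (cluster ends ω t) * zdel p ends Ψ s (cluster ends ω t) *
          ((connEvent ends t s)ᶜ).indicator 1 ω) := by
    intro Ψ hΨ
    rw [← expect_zfun_mul_eq p ends s t F hΨ]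
    refine congrArg (expect p) (funext fun ω => ?_)
    rw [indicator_avoidEvent_eq ends t hs ω]
    simp only [hF]
    ring
  have t1 := tower hΦ
  have t2 := tower hΦ'
  have t3 := tower (isZMono_mul hΦ hΦ' hΦ0 hΦ'0)
  -- Harris in `G ∖ C_t`
  have step1 : expect p (fun ω => F (cluster ends ω t) * (g (cluster ends ω t) *
      g' (cluster ends ω t)) * ((connEvent ends t s)ᶜ).indicator 1 ω) ≤
      expect p (fun ω => Φ (cluster ends ω s) (cluster ends ω t) *
        Φ' (cluster ends ω s) (cluster ends ω t) * (avoidEvent ends t X).indicator 1 ω) := by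
    rw [t3]
    refine expect_mono hp fun ω => ?_
    have hind : 0 ≤ ((connEvent ends t s)ᶜ).indicator (1 : Config E → R) ω :=
      Set.indicator_nonneg (fun _ _ => zero_le_one) ω
    exact mul_le_mul_of_nonneg_right
      (mul_le_mul_of_nonneg_left (hmul _) (hF0 _)) hind
  -- BHK 1.1 with the avoided set `X` for the increasing functionals `F·(1 − g)`, `F·(1 − g')`
  have key := bhk_induced p hp ends t (F₁ := fun C => 1 - g C) (F₂ := fun C => 1 - g' C)
    (fun _ _ h => sub_le_sub_left (hg_anti h) 1)
    (fun _ _ h => sub_le_sub_left (hg'_anti h) 1)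
    (fun C => sub_nonneg.mpr (hg1 C)) (fun C => sub_nonneg.mpr (hg'1 C))
    Finset.univ X X (Finset.subset_univ _) (Finset.subset_univ _)
  simp only [Finset.inter_self, Finset.union_self, REvent_univ] at key
  have e : ∀ H : Set V → R, clusterObs ends Finset.univ t H * (avoidEvent ends t X).indicator 1 =
      fun ω => H (cluster ends ω t) * (avoidEvent ends t X).indicator 1 ω := by
    intro H
    funext ω
    simp only [Pi.mul_apply, clusterObs_apply, clusterIn_univ]
  rw [e, e, e] at key
  simp only [Pi.mul_apply] at key
  -- rewrite the avoidance indicator everywhere as `F(C_t) · 1_{t ↮ s}`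
  have hA : ∀ ω, (avoidEvent ends t X).indicator (1 : Config E → R) ω =
      F (cluster ends ω t) * ((connEvent ends t s)ᶜ).indicator 1 ω :=
    fun ω => indicator_avoidEvent_eq ends t hs ω
  -- abbreviations for the four expectations
  set I : Config E → R := fun ω => ((connEvent ends t s)ᶜ).indicator 1 ω with hI
  have hI0 : ∀ ω, 0 ≤ I ω := fun ω => Set.indicator_nonneg (fun _ _ => zero_le_one) ω
  set a := expect p (fun ω => F (cluster ends ω t) * I ω) with ha
  set x := expect p (fun ω => F (cluster ends ω t) * g (cluster ends ω t) * I ω) with hx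
  set x' := expect p (fun ω => F (cluster ends ω t) * g' (cluster ends ω t) * I ω) with hx'
  set y := expect p (fun ω => F (cluster ends ω t) * (g (cluster ends ω t) *
    g' (cluster ends ω t)) * I ω) with hy
  have hPA : prob p (avoidEvent ends t X) = a := by
    rw [prob_eq_expect_indicator, ha]
    refine congrArg (expect p) (funext fun ω => ?_)
    rw [hA ω]
  -- `key` in terms of `a x x' y`
  have key' : (a - x) * (a - x') ≤ (a - x - x' + y) * a := by
    have l1 : expect p (fun ω => (1 - g (cluster ends ω t)) *
        (avoidEvent ends t X).indicator 1 ω) = a - x := by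
      rw [ha, hx, ← expect_sub]
      refine congrArg (expect p) (funext fun ω => ?_)
      rw [hA ω]; simp only [hI, Pi.sub_apply]; ring
    have l2 : expect p (fun ω => (1 - g' (cluster ends ω t)) *
        (avoidEvent ends t X).indicator 1 ω) = a - x' := by
      rw [ha, hx', ← expect_sub]
      refine congrArg (expect p) (funext fun ω => ?_)
      rw [hA ω]; simp only [hI, Pi.sub_apply]; ring
    have l3 : expect p (fun ω => (1 - g (cluster ends ω t)) * (1 - g' (cluster ends ω t)) *
        (avoidEvent ends t X).indicator 1 ω) = a - x - x' + y := by
      rw [ha, hx, hx', hy, ← expect_sub, ← expect_sub, ← expect_add]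
      refine congrArg (expect p) (funext fun ω => ?_)
      rw [hA ω]; simp only [hI, Pi.sub_apply, Pi.add_apply]; ring
    rw [l1, l2, l3, hPA] at key
    exact key
  have hxy : x * x' ≤ y * a := by nlinarith [key']
  -- assemble
  have e1 : expect p (fun ω => Φ (cluster ends ω s) (cluster ends ω t) *
      (avoidEvent ends t X).indicator 1 ω) = x := by
    rw [t1, hx]
  have e2 : expect p (fun ω => Φ' (cluster ends ω s) (cluster ends ω t) *
      (avoidEvent ends t X).indicator 1 ω) = x' := by
    rw [t2, hx']
  rw [e1, e2, hPA]
  calc x * x' ≤ y * a := hxy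
    _ ≤ expect p (fun ω => Φ (cluster ends ω s) (cluster ends ω t) *
          Φ' (cluster ends ω s) (cluster ends ω t) * (avoidEvent ends t X).indicator 1 ω) * a := by
        refine mul_le_mul_of_nonneg_right ?_ ?_
        · rw [hy]; exact step1
        · rw [ha]
          exact expect_nonneg hp fun ω => mul_nonneg (hF0 _) (hI0 ω)

end CondAvoid

end Summit.Ventures.PercRepro2
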